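import Summits.HodgeConjecture.HodgeConjecture.Theorems.F0P6aStubFROBRoofGeoWiringWiring
import HarnessLib

/-!
# `F0P6aStubFROBRoofGeoWiringAdapters` — ★ RE-HOME of `Lines/F0_P6a_StubFROBRoofGeoWiring.lean` (tree sha16 46cdc102588d6598), PART 2 of 4 — tree lines :340–:633.

See PART 1 `Theorems/F0P6aStubFROBRoofGeoWiringWiring.lean` for the full ★ re-home header and the original module docstring (verbatim there).  Same namespace (every fully-qualified name unchanged);
the scopes open at the cut (`noncomputable section` ∕ `namespace` ∕ `section`s) are re-opened below with their `variable` ∕ `open` ∕ `set_option` ∕ `omit` ∕ `include` ∕ `universe` lines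
replayed verbatim from the tree, in order; the code after the replay block is the tree bytes :340–:633, untouched.  HC_CM is proved only modulo the 7 printed citations (2 remaining: hLiu418 = stmt-HodgeConjecture-24832, h413 = stmt-HodgeConjecture-24833) until rung 0 closes; a re-home is count-neutral.
-/

-- ── replay of the scopes open at tree line :340 (verbatim) ──
set_option autoImplicit false
set_option linter.dupNamespace false
set_option linter.unusedSectionVars false
noncomputable section
namespace Summit.HodgeConjecture.HodgeConjecture.Cruxes.HLiu418.F0P6aStubFROBRoofGeoWiring
open CategoryTheory CategoryTheory.Limits NumberField IsDedekindDomain MulAction AlgebraicGeometry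
open scoped Matrix Pointwise MonoidalCategory MonObj CategoryTheory.Obj Polynomial
open Literature.NumberTheory.GaloisRepresentations
open Literature.NumberTheory.Automorphic Literature.NumberTheory.Automorphic.UnitaryGroup
open Literature.AlgebraicGeometry.ShimuraVarieties.UnitaryCanonicalModel
open Literature.NumberTheory.Automorphic.Liu2021.AppendixC
open Literature.AlgebraicGeometry.Motives (AlgPoints IntegralModel SchemeOver thickening thickeningLift specOver relFrobeniusOver frobeniusTwistOver frobSpec)
open Literature.NumberTheory.DiophantineGeometry (geomResidueField specialFibreFunctor specResidueField)
open Literature.AlgebraicGeometry.RelativeSpec (ActionOver)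
open Literature.AlgebraicGeometry.GroupSchemes Literature.AlgebraicGeometry.GroupSchemes.GroupSchemeKernel
open Literature.AlgebraicGeometry.GroupSchemes.AffineGroupScheme (Alg quotIncl)
open Literature.AlgebraicGeometry.AbelianSchemes Literature.AlgebraicGeometry.AbelianSchemes.AbelianSchemeOver
open Summit.HodgeConjecture.HodgeConjecture.Cruxes.HLiu418.F0P6aModuliDatumDefs
open Summit.HodgeConjecture.HodgeConjecture.Cruxes.HLiu418.F0P6aRGDAssembly
open Summit.HodgeConjecture.HodgeConjecture.Cruxes.HLiu418.F0P6aDatumOfInputs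
open Summit.HodgeConjecture.HodgeConjecture.Cruxes.HLiu418.F0P6aLineSpecialisation (spGeoOf)
open Summit.HodgeConjecture.HodgeConjecture.Cruxes.HLiu418.F0P6aRoofCwKernel (hsat_sch₀Of)
open Summit.HodgeConjecture.HodgeConjecture.Cruxes.HLiu418.F0P6aStubFROBRoofGeo
variable {F : Type} [Field F] [NumberField F] [IsCMField F] [IsGalois ℚ F] {ι₁ : F →+* ℂ}
    {Jstar : Matrix (Fin 2) (Fin 2) F}
    {K₀ : C5.OpenCompactSubgroup ↥(finAdelic ↥(maximalRealSubfield F) F (IsCMField.complexConj F) 2 Jstar)}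
    {S : RecordSystemGS F Jstar ι₁ K₀} {hU7ₛ : S.HeckeTranslateDefinedOver}
    {hJ : (Jstar.map (IsCMField.complexConj F))ᵀ = Jstar} {hJu : IsUnit Jstar}
    {Fi : Type} [Field Fi] [Algebra F Fi] {Kc : C5.SmallLevel K₀} {G : Type} [Group G]
    {𝓜 : IntegralModel (𝓞 F) F ((thickening F Fi).obj (S.M.obj Kc))}
    {w : HeightOneSpectrum (𝓞 F)} {hw : (IsCMField.complexConj F) • w ≠ w} {h𝓨 : (𝓜.localise w).IsSmoothProper 1}
    {θ : ActionOver (𝓜.localise w).total.hom ((Fi ≃ₐ[F] Fi) × G)}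
    {e : Fi →ₐ[F] AlgebraicClosure (w.adicCompletion F)}
-- ── tree bytes :340–:633 ──

/-! ## §I — THE TWO INTERNAL INPUTS OF HEAD″ (LA1-p03 (g4) `W5bInputs.v1` 6f790be4, VERBATIM; `hD` after LA6-p01 (g3) HDPin b4083905) -/

section Inputs

-- the D-line `Letters` frame VERBATIM (upstairs only: no `[IsGalois ℚ F]`, no `[ExpChar …]`)
variable {F : Type} [Field F] [NumberField F] [IsCMField F] {ι₁ : F →+* ℂ}
    {Jstar : Matrix (Fin 2) (Fin 2) F}
    {K₀ : C5.OpenCompactSubgroup ↥(finAdelic ↥(maximalRealSubfield F) F (IsCMField.complexConj F) 2 Jstar)}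
    {S : RecordSystemGS F Jstar ι₁ K₀} {hU7ₛ : S.HeckeTranslateDefinedOver}
    {hJ : (Jstar.map (IsCMField.complexConj F))ᵀ = Jstar} {hJu : IsUnit Jstar}
    {Fi : Type} [Field Fi] [Algebra F Fi] {Kc : C5.SmallLevel K₀} {G : Type} [Group G]
    {𝓜 : IntegralModel (𝓞 F) F ((thickening F Fi).obj (S.M.obj Kc))}
    {w : HeightOneSpectrum (𝓞 F)} {hw : (IsCMField.complexConj F) • w ≠ w} {h𝓨 : (𝓜.localise w).IsSmoothProper 1}
    {θ : ActionOver (𝓜.localise w).total.hom ((Fi ≃ₐ[F] Fi) × G)}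
    {e : Fi →ₐ[F] AlgebraicClosure (w.adicCompletion F)}

/-- **THE LEGS PRESENTATION OF `𝔭_w⁻¹` WITH SCALAR `p`** — `E' = E'²`, columns `P`, rows `Q` with `E'P = P`, `QE' = Q`, `QP = p`, `PQ = p·E'`, and the coordinates of `P`
generating `𝔭_w`: ★ `exists_serrePresentation_of_ideal_of_natCast_mem w.asIdeal w.ne_bot I.hpChar.2` (the prescribed scalar `N := p ∈ 𝔭_w` is the spine letter `I.hpChar.2`),
its two extra conjuncts dropped.  Conclusion = W1-a head′ `roofLegs_of_roofLink_kerRows`'s binders `{m} E' hE' P Q hP hQ hQP hPQ h𝔭` TOKEN FOR TOKEN — RULE 36 (i).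
[cite: Neukirch1999, Ch. I §3 (3.8)–(3.9)] [cite: Conrad2004GrossZagier, §7 (Thm. 7.5)] -/
theorem exists_serrePresentation_w (I : RGDInputsAt F ι₁ Jstar K₀ S hU7ₛ hJ hJu Fi Kc G 𝓜 w hw h𝓨 θ e) :
    ∃ (m : ℕ) (E' : Matrix (Fin m) (Fin m) (𝓞 F)) (_ : E' * E' = E') (P : Matrix (Fin m) (Fin 1) (𝓞 F)) (Q : Matrix (Fin 1) (Fin m) (𝓞 F)),
      E' * P = P ∧ Q * E' = Q ∧ Q * P = Matrix.scalar (Fin 1) (I.pChar : 𝓞 F) ∧ P * Q = Matrix.scalar (Fin m) (I.pChar : 𝓞 F) * E' ∧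
      Ideal.span (Set.range fun k => P k 0) = w.asIdeal := by
  obtain ⟨m, E', hE', P, Q, hP, hQ, hQP, hPQ, hspan, -, -⟩ :=
    Literature.NumberTheory.NumberFields.SerrePresentation.exists_serrePresentation_of_ideal_of_natCast_mem w.asIdeal w.ne_bot I.hpChar.2
  exact ⟨m, E', hE', P, Q, hP, hQ, hQP, hPQ, hspan⟩

/-- **(G1) `hD` IS FREE — THE MODEL-LEVEL UNIT PIN OF THE DATUM'S DUAL PAIR**, `(1 × ε)^* 𝒫 ≅ 𝒪`: the localised model `𝓨 = 𝓜.localise w` is smooth (`h𝓨.1`) over the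
Dedekind domain `𝒪_{F,(w)}` (reduced, Noetherian), hence its total space is REDUCED (★ `isReduced_of_smooth_of_isReduced_base`, Stacks 034E), and then ★
`Polarization.nonempty_unitHatSlice_iso I.pol` gives the pin.  = LA6-p01 (g3) `HDPin.v1` b4083905 `nonempty_unitHatSlice_iso_of_inputs` BY COPY (its reducedness lemma
inlined; credit LA6-p01 (g3), gap (G1) raised by LA1-p01 (g3)).  Conclusion = W1-a head′'s `hD` binder text TOKEN FOR TOKEN — RULE 36 (ii).
[cite: MumfordAV1970, §13 (p. 125), §23 (p. 231)] [cite: StacksProject, Tag 034E] -/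
theorem nonempty_unitHatSlice_iso_of_inputs (I : RGDInputsAt F ι₁ Jstar K₀ S hU7ₛ hJ hJu Fi Kc G 𝓜 w hw h𝓨 θ e) :
    Nonempty ((Scheme.Modules.pullback (DualPair.unitHatSlice I.dual)).obj I.dual.P ≅ SheafOfModules.unit _) := by
  haveI : SmoothOfRelativeDimension 1 (𝓜.localise w).total.hom := h𝓨.1
  haveI : Smooth (𝓜.localise w).total.hom := SmoothOfRelativeDimension.smooth (n := 1) (f := (𝓜.localise w).total.hom)
  haveI : IsLocallyNoetherian (Spec (.of (HeightOneSpectrum.valuationSubringAtPrime F w))) := inferInstance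
  haveI : IsReduced (Spec (.of (HeightOneSpectrum.valuationSubringAtPrime F w))) := inferInstance
  haveI : IsReduced (𝓜.localise w).total.left :=
    Literature.AlgebraicGeometry.Resolution.isReduced_of_smooth_of_isReduced_base (𝓜.localise w).total.hom
  exact Polarization.nonempty_unitHatSlice_iso I.pol

end Inputs


/-! ## §R — THE (RKC) ADAPTERS (LA1-p03 (g4) `RKCAdapters.v2.byname` eda00f64, VERBATIM) -/

open Summit.HodgeConjecture.HodgeConjecture.Cruxes.HLiu418.F0P6aLineSpecialisation
  (LineWOf lineWOfKernel lineWOfKernel_le mem_lineWOfKernel_iff natCard_roofKernel_eq roofKernel_stable natCard_roofKernel_inf_idealTorsionΩ_w_eq)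

section Adapters

-- the D-line `Letters` frame VERBATIM (upstairs only: no `[IsGalois ℚ F]`, no `[ExpChar …]`) — = (RKC)'s and (KEW) §W's frame
variable {F : Type} [Field F] [NumberField F] [IsCMField F] {ι₁ : F →+* ℂ}
    {Jstar : Matrix (Fin 2) (Fin 2) F}
    {K₀ : C5.OpenCompactSubgroup ↥(finAdelic ↥(maximalRealSubfield F) F (IsCMField.complexConj F) 2 Jstar)}
    {S : RecordSystemGS F Jstar ι₁ K₀} {hU7ₛ : S.HeckeTranslateDefinedOver}
    {hJ : (Jstar.map (IsCMField.complexConj F))ᵀ = Jstar} {hJu : IsUnit Jstar}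
    {Fi : Type} [Field Fi] [Algebra F Fi] {Kc : C5.SmallLevel K₀} {G : Type} [Group G]
    {𝓜 : IntegralModel (𝓞 F) F ((thickening F Fi).obj (S.M.obj Kc))}
    {w : HeightOneSpectrum (𝓞 F)} {hw : (IsCMField.complexConj F) • w ≠ w} {h𝓨 : (𝓜.localise w).IsSmoothProper 1}
    {θ : ActionOver (𝓜.localise w).total.hom ((Fi ≃ₐ[F] Fi) × G)}
    {e : Fi →ₐ[F] AlgebraicClosure (w.adicCompletion F)}

variable (I : RGDInputsAt F ι₁ Jstar K₀ S hU7ₛ hJ hJu Fi Kc G 𝓜 w hw h𝓨 θ e)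
  (quotΩ : ∀ y, LineOf I y → AlgPoints (S.M.obj Kc) (AlgebraicClosure (w.adicCompletion F)))
  (translΩ : AlgPoints (S.M.obj Kc) (AlgebraicClosure (w.adicCompletion F)) → AlgPoints (S.M.obj Kc) (AlgebraicClosure (w.adicCompletion F)))

/-- **(R-0) `RoofΩ` RE-PACKAGED FROM ITS SIXTEEN COMPONENTS** — the W5b pen `obtain`s `⟨K, hK1, B, DB, lamB, hlamB, hDB, q, hq, c, hc, r1, r2, r2s, r3q, r3c, r4, r5, …⟩` out of W1-a
head′ `roofLegs_of_roofLink_kerRows … y L`; every (RKC) head wants `hK : (line clause) ∧ RoofΩ … y (quotΩ y L) K` back.  Anonymous constructor (Defs ED. 3 :361 field order),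
the three `IsMonHom` facts explicit (junction form: they arrive as ∃-components, not instances). [cite: MumfordAV1970, §23 Thm. 2 (p. 231); §15 Thm. 1 (p. 143)]
[cite: Liu2021, Prop. D.8 (3) p. 135] -/
theorem roofΩ_of_rows (y y'' : AlgPoints (S.M.obj Kc) (AlgebraicClosure (w.adicCompletion F)))
    (K : Subgroup ((fibreΩOf S Kc 𝓜 w e I.univ y).Points (AlgebraicClosure (w.adicCompletion F))))
    (B : AbelianSchemeOver (Spec (CommRingCat.of (AlgebraicClosure (w.adicCompletion F))))) (DB : B.DualPair) (lamB : B.X ⟶ DB.hat.X) (hlamB : IsMonHom lamB)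
    (hDB : Nonempty ((Scheme.Modules.pullback DB.unitHatSlice).obj DB.P ≅ SheafOfModules.unit _))
    (q : (schΩOf S Kc 𝓜 w e I.univ y).X ⟶ B.X) (hq : IsMonHom q) (c : (schΩOf S Kc 𝓜 w e I.univ y'').X ⟶ B.X) (hc : IsMonHom c)
    (r1 : ∀ P : (fibreΩOf S Kc 𝓜 w e I.univ y).Points (AlgebraicClosure (w.adicCompletion F)), (AlgPoints.map q P : B.toAffine.toAbelianVariety.Points (AlgebraicClosure (w.adicCompletion F))) = 1 ↔ P ∈ K)
    (r2 : ∀ P : (fibreΩOf S Kc 𝓜 w e I.univ y'').Points (AlgebraicClosure (w.adicCompletion F)),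
      (AlgPoints.map c P : B.toAffine.toAbelianVariety.Points (AlgebraicClosure (w.adicCompletion F))) = 1 ↔ IsIdealTorsionΩ S Kc 𝓜 w e I.univ I.act y'' w.asIdeal P)
    (r2s : Function.Surjective c.left.base)
    (r3q : haveI := hlamB; haveI := hq
      q ≫ lamB ≫ DualPair.dualIsogenyOver q (dualΩOf S Kc 𝓜 w e I.univ I.dual y) DB = (polΩOf S Kc 𝓜 w e I.univ I.pol y).lam ≫ (dualΩOf S Kc 𝓜 w e I.univ I.dual y).hat.mulN I.pChar)
    (r3c : haveI := hlamB; haveI := hc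
      c ≫ lamB ≫ DualPair.dualIsogenyOver c (dualΩOf S Kc 𝓜 w e I.univ I.dual y'') DB = (polΩOf S Kc 𝓜 w e I.univ I.pol y'').lam ≫ (dualΩOf S Kc 𝓜 w e I.univ I.dual y'').hat.mulN I.pChar)
    (r4 : ∀ a : 𝓞 F, ∃ b : B.X ⟶ B.X,
      (actΩOf S Kc 𝓜 w e I.univ I.act a y).hom.hom.hom ≫ q = q ≫ b ∧ (actΩOf S Kc 𝓜 w e I.univ I.act a y'').hom.hom.hom ≫ c = c ≫ b)
    (r5 : ∀ a : Fin I.g ⊕ Fin I.g → ZMod I.N,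
      (AlgPoints.map q (lvlPtΩOf S Kc 𝓜 w e I.univ I.lvl y a) : B.toAffine.toAbelianVariety.Points (AlgebraicClosure (w.adicCompletion F))) = AlgPoints.map c (lvlPtΩOf S Kc 𝓜 w e I.univ I.lvl y'' a)) :
    RoofΩ S Kc 𝓜 w e I.univ I.act I.dual I.pol I.lvl I.pChar w.asIdeal y y'' K :=
  ⟨B, DB, lamB, hlamB, hDB, q, hq, c, hc, r1, r2, r2s, r3q, r3c, r4, r5⟩

/-- **(R-a) `H_w := K ∩ A_y[𝔭_w](Ω̄)` AS A `w`-LINE** for the kernel `K` served by `RoofLink I quotΩ` at `(y, L)` (its two clauses `hK`; in W5b `hK := ⟨hK1, roofΩ_of_rows …⟩`):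
(KEW) §W6 `lineWOfKernel I y K hstab hcard` with `hstab :=` (RKC) `roofKernel_stable I quotΩ y L K hK.2` (`K` is `ι`-stable — rows (r1)(r2)(r4), ★ `map_i_mem_of_roof`; the
`actΩROf`∕`actΩOf` seam is `rfl`) and `hcard :=` (RKC) `natCard_roofKernel_inf_idealTorsionΩ_w_eq I quotΩ translΩ hhecke hunit hKc hroof hroof₂ hunr y L K hK`
(`#(K ∩ A_y[𝔭_w]) = p^f`: `#K = p^(2f)` by the three roofs ∘ ★ (ρ2‴), `K[𝔭_{c•w}] = L` of order `p^f`, points-level CRT).  The `Hw` binder of (KEW) HEAD-W `exists_wWitness_of_kerRow`.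
[cite: Liu2021, Prop. D.8 (3) p. 135, pp. 136–138] [cite: MumfordAV1970, §7 Thm. 4 (p. 72)] [cite: AtiyahMacdonald1969, Prop. 1.10] -/
def lineWOfRoof (hhecke : HeckeClause I quotΩ translΩ)
    (hunit : (UnitaryGroup.isUnit_placeForm Jstar hJu w).unit ∈ glInt 2 (w.adicCompletion F))
    (hKc : UnitaryGroup.IsHyperspecialAt ↥(maximalRealSubfield F) F (IsCMField.complexConj F) 2 Jstar Kc.1.1 (w.under (𝓞 ↥(maximalRealSubfield F))))
    (hroof : RoofLink I quotΩ) (hroof₂ : RoofLink₂ I translΩ) (hunr : ¬ (w.asIdeal ^ 2 ∣ Ideal.span {((I.pChar : ℕ) : 𝓞 F)}))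
    (y : AlgPoints (S.M.obj Kc) (AlgebraicClosure (w.adicCompletion F))) (L : LineOf I y) (K : Subgroup ((fibreΩOf S Kc 𝓜 w e I.univ y).Points (AlgebraicClosure (w.adicCompletion F))))
    (hK : (∀ P, P ∈ L.1 ↔ P ∈ K ∧ IsIdealTorsionΩ S Kc 𝓜 w e I.univ I.act y ((IsCMField.complexConj F) • w).asIdeal P) ∧
      RoofΩ S Kc 𝓜 w e I.univ I.act I.dual I.pol I.lvl I.pChar w.asIdeal y (quotΩ y L) K) :
    LineWOf I y :=
  lineWOfKernel I y K (fun a P hP => roofKernel_stable I quotΩ y L K hK.2 a P hP)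
    (natCard_roofKernel_inf_idealTorsionΩ_w_eq I quotΩ translΩ hhecke hunit hKc hroof hroof₂ hunr y L K hK)

/-- **(R-a) `H_w ⊆ K`** — the `hHK` binder of (KEW) HEAD-W `exists_wWitness_of_kerRow` ((KEW) §W6 `lineWOfKernel_le`). [cite: Liu2021, Prop. D.8 (3) p. 135] -/
theorem lineWOfRoof_le (hhecke : HeckeClause I quotΩ translΩ)
    (hunit : (UnitaryGroup.isUnit_placeForm Jstar hJu w).unit ∈ glInt 2 (w.adicCompletion F))
    (hKc : UnitaryGroup.IsHyperspecialAt ↥(maximalRealSubfield F) F (IsCMField.complexConj F) 2 Jstar Kc.1.1 (w.under (𝓞 ↥(maximalRealSubfield F))))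
    (hroof : RoofLink I quotΩ) (hroof₂ : RoofLink₂ I translΩ) (hunr : ¬ (w.asIdeal ^ 2 ∣ Ideal.span {((I.pChar : ℕ) : 𝓞 F)}))
    (y : AlgPoints (S.M.obj Kc) (AlgebraicClosure (w.adicCompletion F))) (L : LineOf I y) (K : Subgroup ((fibreΩOf S Kc 𝓜 w e I.univ y).Points (AlgebraicClosure (w.adicCompletion F))))
    (hK : (∀ P, P ∈ L.1 ↔ P ∈ K ∧ IsIdealTorsionΩ S Kc 𝓜 w e I.univ I.act y ((IsCMField.complexConj F) • w).asIdeal P) ∧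
      RoofΩ S Kc 𝓜 w e I.univ I.act I.dual I.pol I.lvl I.pChar w.asIdeal y (quotΩ y L) K) :
    ∀ P ∈ (lineWOfRoof I quotΩ translΩ hhecke hunit hKc hroof hroof₂ hunr y L K hK).1, P ∈ K :=
  lineWOfKernel_le I y K _ _

/-- **(R-a) membership in `H_w`: `P ∈ H_w ↔ P ∈ K ∧ ι(𝔭_w) P = 1`** (LA2-p03's subtype currency; (KEW) §W6 `mem_lineWOfKernel_iff`). [cite: Liu2021, Prop. D.8 (3) p. 135] -/
theorem mem_lineWOfRoof_iff (hhecke : HeckeClause I quotΩ translΩ)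
    (hunit : (UnitaryGroup.isUnit_placeForm Jstar hJu w).unit ∈ glInt 2 (w.adicCompletion F))
    (hKc : UnitaryGroup.IsHyperspecialAt ↥(maximalRealSubfield F) F (IsCMField.complexConj F) 2 Jstar Kc.1.1 (w.under (𝓞 ↥(maximalRealSubfield F))))
    (hroof : RoofLink I quotΩ) (hroof₂ : RoofLink₂ I translΩ) (hunr : ¬ (w.asIdeal ^ 2 ∣ Ideal.span {((I.pChar : ℕ) : 𝓞 F)}))
    (y : AlgPoints (S.M.obj Kc) (AlgebraicClosure (w.adicCompletion F))) (L : LineOf I y) (K : Subgroup ((fibreΩOf S Kc 𝓜 w e I.univ y).Points (AlgebraicClosure (w.adicCompletion F))))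
    (hK : (∀ P, P ∈ L.1 ↔ P ∈ K ∧ IsIdealTorsionΩ S Kc 𝓜 w e I.univ I.act y ((IsCMField.complexConj F) • w).asIdeal P) ∧
      RoofΩ S Kc 𝓜 w e I.univ I.act I.dual I.pol I.lvl I.pChar w.asIdeal y (quotΩ y L) K)
    (P : (fibreΩOf S Kc 𝓜 w e I.univ y).Points (AlgebraicClosure (w.adicCompletion F))) :
    P ∈ (lineWOfRoof I quotΩ translΩ hhecke hunit hKc hroof hroof₂ hunr y L K hK).1 ↔ P ∈ K ∧ IsIdealTorsionΩ S Kc 𝓜 w e I.univ I.act y w.asIdeal P :=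
  mem_lineWOfKernel_iff I y K _ _ P

/-- **(R-a) ∃-PACKED: a `w`-line `H_w ≤ K` reading `K ∩ A_y[𝔭_w]`** — the `(Hw, hHK)` pair of (KEW) HEAD-W in one `obtain`. [cite: Liu2021, Prop. D.8 (3) p. 135, pp. 136–138] -/
theorem exists_lineWOf_of_roof (hhecke : HeckeClause I quotΩ translΩ)
    (hunit : (UnitaryGroup.isUnit_placeForm Jstar hJu w).unit ∈ glInt 2 (w.adicCompletion F))
    (hKc : UnitaryGroup.IsHyperspecialAt ↥(maximalRealSubfield F) F (IsCMField.complexConj F) 2 Jstar Kc.1.1 (w.under (𝓞 ↥(maximalRealSubfield F))))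
    (hroof : RoofLink I quotΩ) (hroof₂ : RoofLink₂ I translΩ) (hunr : ¬ (w.asIdeal ^ 2 ∣ Ideal.span {((I.pChar : ℕ) : 𝓞 F)}))
    (y : AlgPoints (S.M.obj Kc) (AlgebraicClosure (w.adicCompletion F))) (L : LineOf I y) (K : Subgroup ((fibreΩOf S Kc 𝓜 w e I.univ y).Points (AlgebraicClosure (w.adicCompletion F))))
    (hK : (∀ P, P ∈ L.1 ↔ P ∈ K ∧ IsIdealTorsionΩ S Kc 𝓜 w e I.univ I.act y ((IsCMField.complexConj F) • w).asIdeal P) ∧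
      RoofΩ S Kc 𝓜 w e I.univ I.act I.dual I.pol I.lvl I.pChar w.asIdeal y (quotΩ y L) K) :
    ∃ Hw : LineWOf I y, (∀ P ∈ Hw.1, P ∈ K) ∧
      ∀ P : (fibreΩOf S Kc 𝓜 w e I.univ y).Points (AlgebraicClosure (w.adicCompletion F)), P ∈ Hw.1 ↔ P ∈ K ∧ IsIdealTorsionΩ S Kc 𝓜 w e I.univ I.act y w.asIdeal P :=
  ⟨lineWOfRoof I quotΩ translΩ hhecke hunit hKc hroof hroof₂ hunr y L K hK, lineWOfRoof_le I quotΩ translΩ hhecke hunit hKc hroof hroof₂ hunr y L K hK,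
    mem_lineWOfRoof_iff I quotΩ translΩ hhecke hunit hKc hroof hroof₂ hunr y L K hK⟩

/-- **(R-b) `#Ker q(Ω̄) = p^f · p^f` FOR THE ROOF LEG `q` at `(y, L)`**: ★ (RK-count) bridge `natCard_kerPoints_eq_mul_self_of_forall_iff_of_natCard_eq_pow_two_mul` over the points
clause (r1) and (RKC) `natCard_roofKernel_eq` (`#K = p^(2f)`: three roofs ∘ ★ (ρ2‴) `natCard_eq_of_three_roofs'`). [cite: GortzWedhorn2023, (27.1.1)] [cite: MumfordAV1970, §7 Thm. 4 (p. 72)]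
[cite: Liu2021, Prop. D.8 (pp. 135–138)] -/
theorem natCard_kerPoints_roofLeg_eq (hhecke : HeckeClause I quotΩ translΩ)
    (hunit : (UnitaryGroup.isUnit_placeForm Jstar hJu w).unit ∈ glInt 2 (w.adicCompletion F))
    (hKc : UnitaryGroup.IsHyperspecialAt ↥(maximalRealSubfield F) F (IsCMField.complexConj F) 2 Jstar Kc.1.1 (w.under (𝓞 ↥(maximalRealSubfield F))))
    (hroof : RoofLink I quotΩ) (hroof₂ : RoofLink₂ I translΩ)
    (y : AlgPoints (S.M.obj Kc) (AlgebraicClosure (w.adicCompletion F))) (L : LineOf I y) (K : Subgroup ((fibreΩOf S Kc 𝓜 w e I.univ y).Points (AlgebraicClosure (w.adicCompletion F))))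
    (hK : (∀ P, P ∈ L.1 ↔ P ∈ K ∧ IsIdealTorsionΩ S Kc 𝓜 w e I.univ I.act y ((IsCMField.complexConj F) • w).asIdeal P) ∧
      RoofΩ S Kc 𝓜 w e I.univ I.act I.dual I.pol I.lvl I.pChar w.asIdeal y (quotΩ y L) K)
    {B : AbelianSchemeOver (Spec (CommRingCat.of (AlgebraicClosure (w.adicCompletion F))))} (q : (schΩOf S Kc 𝓜 w e I.univ y).X ⟶ B.X) [IsMonHom q]
    (r1 : ∀ P : (fibreΩOf S Kc 𝓜 w e I.univ y).Points (AlgebraicClosure (w.adicCompletion F)), (AlgPoints.map q P : B.toAffine.toAbelianVariety.Points (AlgebraicClosure (w.adicCompletion F))) = 1 ↔ P ∈ K) :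
    Nat.card (Literature.AlgebraicGeometry.Motives.AbelianVariety.Hom.kerPoints (specOver (AlgebraicClosure (w.adicCompletion F)) (AlgebraicClosure (w.adicCompletion F))) (homOfIsMonHom q)) =
      I.pChar ^ I.fDeg * I.pChar ^ I.fDeg :=
  natCard_kerPoints_eq_mul_self_of_forall_iff_of_natCard_eq_pow_two_mul q K r1
    (natCard_roofKernel_eq I quotΩ translΩ hhecke hunit hKc hroof hroof₂ y L K hK)

/-- **(R-b) `HoleRkK` FROM THE (RK₀) ROW, BY VALUE**: for ANY number `n` carrying the (RK₀) row «`n = #Ker q(Ω̄)`» of W1-a head′ (there `n := finrank κ̄ (Alg (ker q̄))`, in whatever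
spelling of `q̄` — the D-line carriers or `qbarOf y L`), `n = p^f · p^f` — W5b §E′ `HoleRkK`'s body token for token once `n` is `finrank κ̄ (Alg (ker (qbarOf y L)))`.
[cite: GortzWedhorn2023, (27.1.1)] [cite: Liu2021, Prop. D.8 (pp. 135–138)] -/
theorem eq_mul_self_of_rkRow (hhecke : HeckeClause I quotΩ translΩ)
    (hunit : (UnitaryGroup.isUnit_placeForm Jstar hJu w).unit ∈ glInt 2 (w.adicCompletion F))
    (hKc : UnitaryGroup.IsHyperspecialAt ↥(maximalRealSubfield F) F (IsCMField.complexConj F) 2 Jstar Kc.1.1 (w.under (𝓞 ↥(maximalRealSubfield F))))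
    (hroof : RoofLink I quotΩ) (hroof₂ : RoofLink₂ I translΩ)
    (y : AlgPoints (S.M.obj Kc) (AlgebraicClosure (w.adicCompletion F))) (L : LineOf I y) (K : Subgroup ((fibreΩOf S Kc 𝓜 w e I.univ y).Points (AlgebraicClosure (w.adicCompletion F))))
    (hK : (∀ P, P ∈ L.1 ↔ P ∈ K ∧ IsIdealTorsionΩ S Kc 𝓜 w e I.univ I.act y ((IsCMField.complexConj F) • w).asIdeal P) ∧
      RoofΩ S Kc 𝓜 w e I.univ I.act I.dual I.pol I.lvl I.pChar w.asIdeal y (quotΩ y L) K)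
    {B : AbelianSchemeOver (Spec (CommRingCat.of (AlgebraicClosure (w.adicCompletion F))))} (q : (schΩOf S Kc 𝓜 w e I.univ y).X ⟶ B.X) [IsMonHom q]
    (r1 : ∀ P : (fibreΩOf S Kc 𝓜 w e I.univ y).Points (AlgebraicClosure (w.adicCompletion F)), (AlgPoints.map q P : B.toAffine.toAbelianVariety.Points (AlgebraicClosure (w.adicCompletion F))) = 1 ↔ P ∈ K)
    {n : ℕ} (hRK : n = Nat.card (Literature.AlgebraicGeometry.Motives.AbelianVariety.Hom.kerPoints (specOver (AlgebraicClosure (w.adicCompletion F)) (AlgebraicClosure (w.adicCompletion F))) (homOfIsMonHom q))) :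
    n = I.pChar ^ I.fDeg * I.pChar ^ I.fDeg :=
  hRK.trans (natCard_kerPoints_roofLeg_eq I quotΩ translΩ hhecke hunit hKc hroof hroof₂ y L K hK q r1)

end Adapters


/-! ## §A — THE W1-a `choose` ADAPTER (LA3-p02 (g3) `W5bSectionA.W1aAdapter.byname.v4` 5a00402b, VERBATIM) -/

open Literature.NumberTheory.EllipticCurves (genericFibre specGenericPoint)
open Summit.HodgeConjecture.HodgeConjecture.Cruxes.HLiu418.F0P6aStubFROBRoofLegs (roofLegs_of_roofLink_kerRows)
open Literature.AlgebraicGeometry.Motives (extendPoint specValuationSubring specFractionFieldι specRingHomι)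
open Literature.NumberTheory.DiophantineGeometry (toClosureValuationSubring geomClosedPointIsoSpecResidueField)

section W1aAdapter

omit [IsCMField F] [IsGalois ℚ F] in
/-- `(act₀Of 𝓜 w 𝒜 ρ a x̄).hom.hom.hom` IS `((ρ ×_𝓨 𝓨_s) ×_{𝓨_s} x̄)(a)` (★ `fibreHom_hom_hom_hom`; `rfl`) — the seam between W1-a's RAW (r4₀-q) row and `HoleR4q`, for BOTH
actions (`I.act` on `I.univ` and `serreAction I.act E' hE'` on `𝒞`). [cite: Kottwitz1992, §5 (p. 390)] -/
theorem act₀Of_hom_hom_hom_eq_baseChange_i {X : SchemeOver F} (𝓜₀ : IntegralModel (𝓞 F) F X) (w₀ : HeightOneSpectrum (𝓞 F))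
    (𝒜 : AbelianSchemeOver (𝓜₀.localise w₀).total.left) (ρ : AbelianSchemeOver.RingAction (𝓞 F) 𝒜)
    (xbar : AlgPoints (𝓜₀.localise w₀).reductionAt (geomResidueField w₀)) (a : 𝓞 F) :
    (act₀Of 𝓜₀ w₀ 𝒜 ρ a xbar).hom.hom.hom =
      ((ρ.baseChange (pullback.fst (𝓜₀.localise w₀).total.hom (specResidueField w₀))).baseChange xbar.left).i a := rfl

set_option backward.isDefEq.respectTransparency false in
set_option maxHeartbeats 400000 in
/-- **THE W1-a ADAPTER.**  From W1-a's head′ `roofLegs_of_roofLink_kerRows` (ONE ∃ per `(y, L)`, LA1-p04 (g3) cand of record v5 082e2a3d), by ONE `choose`: the reduced leg as a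
FUNCTION `qbarOf : QbarTy I quotΩ E' hE'` together with W5a's frozen holes `HoleMono`, `HoleR1`, `HoleR4q` (the RAW row moved to `act₀Of` currency along the two `rfl`
seams `act₀Of_hom_hom_hom_eq_baseChange_i`), `HoleR5q`, `HoleR3q` (Defs `sch₀Of∕dual₀Of∕pol₀Of` = the raw base changes, `rfl`), the (FIN₀) row (W5b `HoleFin` body), and — per `(y, L)` —
head′'s UPSTAIRS roof (`K`, line clause, `B DB λ_B q c`, (r1)–(r5)) followed by (K3₀)(K2₀)(K4₀)(FIN₀)(RK₀) AT `q̄ := qbarOf y L` ((K3₀) = (KEW)∕(KE) `hK3` AS IS — the input of `HoleKill`∕`HoleCLW`) (the inputs of `HoleKer` — via (K2₀) at `𝔭_w·𝔭_{c•w}`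
and the upstairs torsion of `K` — and of `HoleRkK` — via (RK₀) + (r1) + (RKC) `natCard_roofKernel_eq`, LA1-p03 (g4) §R).  [cite: Liu2021, Prop. D.8 (3) p. 135, pp. 136–138]
[cite: RapoportSmithlingZhang2020Diagonal, §4.1 p. 17; §4.3 (4.23) p. 21] -/
theorem exists_qbarOf_of_roofLegs (I : RGDInputsAt F ι₁ Jstar K₀ S hU7ₛ hJ hJu Fi Kc G 𝓜 w hw h𝓨 θ e) [ExpChar (geomResidueField w) I.pChar]
    (quotΩ : ∀ y, LineOf I y → AlgPoints (S.M.obj Kc) (AlgebraicClosure (w.adicCompletion F)))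
    {m : ℕ} (E' : Matrix (Fin m) (Fin m) (𝓞 F)) (hE' : E' * E' = E') (P : Matrix (Fin m) (Fin 1) (𝓞 F)) (Q : Matrix (Fin 1) (Fin m) (𝓞 F))
    (hP : E' * P = P) (hQ : Q * E' = Q) (hQP : Q * P = Matrix.scalar (Fin 1) (I.pChar : 𝓞 F))
    (hPQ : P * Q = Matrix.scalar (Fin m) (I.pChar : 𝓞 F) * E') (h𝔭 : Ideal.span (Set.range fun k => P k 0) = w.asIdeal)
    (hD : Nonempty ((Scheme.Modules.pullback (DualPair.unitHatSlice I.dual)).obj I.dual.P ≅ SheafOfModules.unit _))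
    (hroof : RoofLink I quotΩ) :
    haveI := I.comm
    haveI : IsProper (𝓜.localise w).total.hom := h𝓨.2
    ∃ (qbarOf : QbarTy I quotΩ E' hE') (hmono : HoleMono I quotΩ E' hE' qbarOf),
      HoleR1 I quotΩ E' hE' qbarOf ∧ HoleR4q I quotΩ E' hE' qbarOf ∧ HoleR5q I quotΩ E' hE' P qbarOf ∧ HoleR3q I quotΩ E' hE' P qbarOf hmono ∧
      (∀ (y : AlgPoints (S.M.obj Kc) (AlgebraicClosure (w.adicCompletion F))) (L : LineOf I y), IsFinite (qbarOf y L).left) ∧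
      ∀ (y : AlgPoints (S.M.obj Kc) (AlgebraicClosure (w.adicCompletion F))) (L : LineOf I y),
        haveI := hmono y L
        ∃ K : Subgroup ((fibreΩOf S Kc 𝓜 w e I.univ y).Points (AlgebraicClosure (w.adicCompletion F))),
        (∀ P, P ∈ L.1 ↔ P ∈ K ∧ IsIdealTorsionΩ S Kc 𝓜 w e I.univ I.act y ((IsCMField.complexConj F) • w).asIdeal P) ∧
        ∃ (B : Literature.AlgebraicGeometry.AbelianSchemes.AbelianSchemeOver (AlgebraicGeometry.Spec (CommRingCat.of (AlgebraicClosure (w.adicCompletion F)))))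
          (DB : B.DualPair) (lamB : B.X ⟶ DB.hat.X) (_ : IsMonHom lamB)
          -- J12 INTERFACE PIN (ref1 (g2) e-12): `B̂`'s Poincaré sheaf is normalised along `A × {ε_B̂}` — the unit clause `hD_B` (for a ★ `Polarization` it is ★ `Polarization.nonempty_unitHatSlice_iso`)
          (_ : Nonempty ((AlgebraicGeometry.Scheme.Modules.pullback DB.unitHatSlice).obj DB.P ≅ SheafOfModules.unit _))
          (q : (schΩOf S Kc 𝓜 w e I.univ y).X ⟶ B.X) (_ : IsMonHom q)
          (c : (schΩOf S Kc 𝓜 w e I.univ (quotΩ y L)).X ⟶ B.X) (_ : IsMonHom c),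
          -- (r1) kernel of `q` on `Ω`-points
          (∀ P : (fibreΩOf S Kc 𝓜 w e I.univ y).Points (AlgebraicClosure (w.adicCompletion F)),
              (AlgPoints.map q P : B.toAffine.toAbelianVariety.Points (AlgebraicClosure (w.adicCompletion F))) = 1 ↔ P ∈ K) ∧
          -- (r2) kernel of `c` on `Ω`-points = the `𝔞`-torsion; `c` surjective
          (∀ P : (fibreΩOf S Kc 𝓜 w e I.univ (quotΩ y L)).Points (AlgebraicClosure (w.adicCompletion F)),
              (AlgPoints.map c P : B.toAffine.toAbelianVariety.Points (AlgebraicClosure (w.adicCompletion F))) = 1 ↔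
                IsIdealTorsionΩ S Kc 𝓜 w e I.univ I.act (quotΩ y L) w.asIdeal P) ∧
          Function.Surjective c.left.base ∧
          -- (r3) polarisations: `q^* λ_B = p • λ_y`, `c^* λ_B = p • λ_y″`
          q ≫ lamB ≫ Literature.AlgebraicGeometry.AbelianSchemes.AbelianSchemeOver.DualPair.dualIsogenyOver q (dualΩOf S Kc 𝓜 w e I.univ I.dual y) DB =
            (polΩOf S Kc 𝓜 w e I.univ I.pol y).lam ≫ (dualΩOf S Kc 𝓜 w e I.univ I.dual y).hat.mulN I.pChar ∧
          c ≫ lamB ≫ Literature.AlgebraicGeometry.AbelianSchemes.AbelianSchemeOver.DualPair.dualIsogenyOver c (dualΩOf S Kc 𝓜 w e I.univ I.dual (quotΩ y L)) DB =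
            (polΩOf S Kc 𝓜 w e I.univ I.pol (quotΩ y L)).lam ≫ (dualΩOf S Kc 𝓜 w e I.univ I.dual (quotΩ y L)).hat.mulN I.pChar ∧
          -- (r4) `𝒪_F`-equivariance through a common endomorphism of `B`
          (∀ a : 𝓞 F, ∃ b : B.X ⟶ B.X,
              (actΩOf S Kc 𝓜 w e I.univ I.act a y).hom.hom.hom ≫ q = q ≫ b ∧ (actΩOf S Kc 𝓜 w e I.univ I.act a (quotΩ y L)).hom.hom.hom ≫ c = c ≫ b) ∧
          -- (r5) level-`N` points correspond
          (∀ a : Fin I.g ⊕ Fin I.g → ZMod I.N,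
              (AlgPoints.map q (lvlPtΩOf S Kc 𝓜 w e I.univ I.lvl y a) : B.toAffine.toAbelianVariety.Points (AlgebraicClosure (w.adicCompletion F))) =
                AlgPoints.map c (lvlPtΩOf S Kc 𝓜 w e I.univ I.lvl (quotΩ y L) a)) ∧
            -- (K3₀) model KILL along a flat `𝒦 ↪ I.univ_ỹ` over `R = 𝒪_Ω̄` (`ỹ := extendPoint … (ℓ_e y)` the `R`-point extending `y` = LS `liftOf`): if `𝒦_η`, read in `A_y` through ★ (d5)'s three-piece
            -- isomorphism (= LS `isoGenericOf` by `hσΩ`), is killed by the LEG `q`, then `𝒦_s`, read in `sch₀Of … (red₀ y)` (= LS `isoSpecialOf` by `hσκ`), is killed by `q̄` — EXACTLY (KEW) `…_of_kerRow`'s `hK3`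
            (∀ (𝒦 : Over (Spec (.of (closureValuationSubring (w.adicCompletion F))))) (incl : 𝒦 ⟶ (I.univ.baseChange (extendPoint (closureValuationSubring (w.adicCompletion F)) (toClosureValuationSubring w) (𝓜.localise w).total ((𝓜.localise w).modelPointsEquiv.symm (thickeningLift e (S.M.obj Kc) y))).left).X) [Flat 𝒦.hom],
              ((Over.pullback (specFractionFieldι (closureValuationSubring (w.adicCompletion F)) (toClosureValuationSubring w)).left).map incl ≫
                  (I.univ.fibreBaseChangeIso ((𝓜.localise w).genericIso'.inv.left ≫ pullback.fst (𝓜.localise w).total.hom (specGenericPoint (HeightOneSpectrum.valuationSubringAtPrime F w) F)) (thickeningLift e (S.M.obj Kc) y).left ≪≫ I.univ.fibreCongrPtIso ((𝓜.localise w).left_specFractionFieldι_comp_extendPoint_modelPointsEquiv_symm (thickeningLift e (S.M.obj Kc) y)).symm ≪≫ (I.univ.fibreBaseChangeIso (extendPoint (closureValuationSubring (w.adicCompletion F)) (toClosureValuationSubring w) (𝓜.localise w).total ((𝓜.localise w).modelPointsEquiv.symm (thickeningLift e (S.M.obj Kc) y))).left (specFractionFieldι (closureValuationSubring (w.adicCompletion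 F)) (toClosureValuationSubring w)).left).symm).inv.hom.hom.hom) ≫ q = 1 →
              ((Over.pullback ((geomClosedPointIsoSpecResidueField w).inv.left ≫ (specRingHomι (closureValuationSubring (w.adicCompletion F)) (toClosureValuationSubring w) (IsLocalRing.residue (closureValuationSubring (w.adicCompletion F)))).left)).map incl ≫
                  (I.univ.fibreBaseChangeIso (pullback.fst (𝓜.localise w).total.hom (specResidueField w)) ((𝓜.localise w).geomReductionMap (thickeningLift e (S.M.obj Kc) y)).left ≪≫ I.univ.fibreCongrPtIso (((𝓜.localise w).left_geomReductionMap_comp_fst (thickeningLift e (S.M.obj Kc) y)).trans (Category.assoc _ _ _).symm) ≪≫ (I.univ.fibreBaseChangeIso (extendPoint (closureValuationSubring (w.adicCompletion F)) (toClosureValuationSubring w) (𝓜.localise w).total ((𝓜.localise w).modelPointsEquiv.symm (thickeningLift e (S.M.obj Kc) y))).left ((geomClosedPointIsoSpecResidueField w).inv.left ≫ (specRingHomι (closureValuationSubring (w.adicCompletion F)) (toClosureValuationSubring w) (IsLocalRing.residue (closureValuationSubring (w.adicCompletion F)))).left)).symm).inv.hom.hom.hom) ≫ qbarOf y L = 1)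 ∧
            -- (K2₀) for every ideal `𝔞`: `Ker q(Ω̄) ⊆ A_y[𝔞](Ω̄)` on points ⇒ `Ker q̄ ⊆ A_{red₀ y}[𝔞]` on ALL `T`-points (★ currency; `IsIdealTorsionΩ … y 𝔞 Pt` and
            -- `(act₀Of 𝓜 w I.univ I.act r (red₀Of … y)).hom.hom.hom` unfold to the two `.i r` terms by `actΩOf_hom_hom_hom` ∕ `act₀Of_hom_hom_hom` (rfl)); at `𝔞 := 𝔭_w·𝔭_{c•w}` = W3∕W5's `hker`
            (∀ 𝔞 : Ideal (𝓞 F),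
              (∀ Pt : ((I.univ.baseChange ((𝓜.localise w).genericIso'.inv.left ≫ pullback.fst (𝓜.localise w).total.hom (specGenericPoint (HeightOneSpectrum.valuationSubringAtPrime F w) F))).baseChange
                  (thickeningLift e (S.M.obj Kc) y).left).toAffine.toAbelianVariety.Points (AlgebraicClosure (w.adicCompletion F)),
                (AlgPoints.map q Pt : B.toAffine.toAbelianVariety.Points (AlgebraicClosure (w.adicCompletion F))) = 1 →
                  ∀ r ∈ 𝔞, (AlgPoints.map (((I.act.baseChange ((𝓜.localise w).genericIso'.inv.left ≫ pullback.fst (𝓜.localise w).total.hom (specGenericPoint (HeightOneSpectrum.valuationSubringAtPrime F w) F))).baseChange (thickeningLift e (S.M.obj Kc) y).left).i r) Pt :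
                    ((I.univ.baseChange ((𝓜.localise w).genericIso'.inv.left ≫ pullback.fst (𝓜.localise w).total.hom (specGenericPoint (HeightOneSpectrum.valuationSubringAtPrime F w) F))).baseChange
                      (thickeningLift e (S.M.obj Kc) y).left).toAffine.toAbelianVariety.Points (AlgebraicClosure (w.adicCompletion F))) = 1) →
              ∀ ⦃T : SchemeOver (geomResidueField w)⦄ (z : T ⟶ (sch₀Of 𝓜 w I.univ (red₀Of S Kc 𝓜 w h𝓨 e y)).X),
                z ≫ qbarOf y L = 1 → ∀ r ∈ 𝔞, z ≫ (act₀Of 𝓜 w I.univ I.act r (red₀Of S Kc 𝓜 w h𝓨 e y)).hom.hom.hom = 1) ∧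
            -- (K4₀) degree, (FIN₀) finiteness, (RK₀) `rk Γ(Ker q̄) = #Ker q(Ω̄)` of the reduced leg
            Literature.AlgebraicGeometry.Motives.AbelianVariety.Hom.kerRank (homOfIsMonHom (qbarOf y L)) = Literature.AlgebraicGeometry.Motives.AbelianVariety.Hom.kerRank (homOfIsMonHom q) ∧
            IsFinite (qbarOf y L).left ∧
            Module.finrank (geomResidueField w) (Literature.AlgebraicGeometry.GroupSchemes.AffineGroupScheme.Alg (Literature.AlgebraicGeometry.GroupSchemes.GroupSchemeKernel.ker (qbarOf y L))) =
              Nat.card (Literature.AlgebraicGeometry.Motives.AbelianVariety.Hom.kerPoints (specOver (AlgebraicClosure (w.adicCompletion F)) (AlgebraicClosure (w.adicCompletion F))) (homOfIsMonHom q)) := by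
  haveI := I.comm
  haveI : IsProper (𝓜.localise w).total.hom := h𝓨.2
  choose K hK B DB lamB iL hDB q iq c ic hr1 hr2 hsurj hr3q hr3c hr4 hr5 qbar iqb hr1₀ hr4₀ hr5₀ hr3₀ hK3₀ hK2₀ hK4₀ hFIN₀ hRK₀ using
    roofLegs_of_roofLink_kerRows I E' hE' P Q hP hQ hQP hPQ h𝔭 hD quotΩ hroof
  refine ⟨qbar, iqb, hr1₀, fun y L a => ?_, hr5₀, hr3₀, hFIN₀, fun y L => ⟨K y L, hK y L, B y L, DB y L, lamB y L, iL y L, hDB y L, q y L, iq y L,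
    c y L, ic y L, hr1 y L, hr2 y L, hsurj y L, hr3q y L, hr3c y L, hr4 y L, hr5 y L, hK3₀ y L,
    fun 𝔞 hΩ T z hz r hr => ?_, hK4₀ y L, hFIN₀ y L, hRK₀ y L⟩⟩
  · -- (B4) in `act₀Of` currency: the two `rfl` seams
    rw [act₀Of_hom_hom_hom_eq_baseChange_i, act₀Of_hom_hom_hom_eq_baseChange_i]
    exact hr4₀ y L a
  · -- (K2₀) in `act₀Of` currency
    rw [act₀Of_hom_hom_hom_eq_baseChange_i]
    exact hK2₀ y L 𝔞 hΩ z hz r hr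

end W1aAdapter


/-! ## §D — HOLE DISCHARGERS (C) `HoleKer`, (RK) `HoleRkK` FROM THE §A BLOCK (LA3-p02 (g3) `W5bHoleDischargers.byname.v1` 9a58673b, VERBATIM) -/

open Literature.NumberTheory.EllipticCurves (genericFibre specGenericPoint)
open Summit.HodgeConjecture.HodgeConjecture.Cruxes.HLiu418.F0P6aLineSpecialisation (isIdealTorsionΩ_mul_of_roofLink natCard_roofKernel_eq)


/-! (★ re-home, size lint: PART 2 of 4 ends here at tree line :633; continued in `Theorems/F0P6aStubFROBRoofGeoWiringHoleDischargers.lean`.) -/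

end Summit.HodgeConjecture.HodgeConjecture.Cruxes.HLiu418.F0P6aStubFROBRoofGeoWiring
end
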